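import Literature.Computability.Cryptography.ShiftSamplingFamily
import Literature.Computability.QuantumComplexity.CleanBlockDesc
import Literature.Computability.Cryptography.QuantumCircuitDescFP
import HarnessLib

/-!
# Fourier sampling of a computed table by eigenvalue estimation of shifts, III: uniformity

Topic `Computability/Cryptography`; sequel of `ShiftSamplingFamily.lean`. The quantum core
`family P hbf` (the sandwich circuit around the compiled block of a polynomial-time table) is
polynomial-time uniform, given counter expressions for the parameters (`GEParams`): its description
`1ⁿ ↦ ⟨bin n, ⟨1^{anc n}, encode (circ n)⟩⟩` is the concatenation of pieces rendered from generator
programs (`RevTableauUniform.lean`/`RevUncomputeUniform.lean`: header, the two Hadamard layers, the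
phase layer `S³` on the sine-test controls) and of the description of the clean block
(`CleanBlockDesc.flatMap_opBits_cleanOps_mem_FP`), exactly as for Kitaev's order-finding family
(`KitaevFamilyUniform.lean`; Shor 1997, §2, p. 7: "the design of the gate array be produced by a
polynomial-time (classical) computation"; Kitaev 1995, §4, p. 15: "our procedure is uniform").
Theorem-and-definition file, no named facts.

* `GEParams P` (expressions for `nU`, `L`, `Lv`, `B` in the family index), the derived `KE`, `K1E`,
  `K2E`, `KCE`, `dataNE`, `NE`, `ancE` (`mW_eq`, `eval_ancE`);
* the generators `headerG`, `hLayer1G`, `hLayer2G`, `phaseG`, their streams, the pieces `pieceA`,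
  `pieceB` (the clean block), `pieceC`, `descS`, **`descS_mem_FP`**;
* the closed forms `flatMap_gateEnc_hadamardLayer`, `flatMap_gateEnc_yWires`,
  `flatMap_gateEnc_phaseLayer` (`famσ_eq`: the type of a control from its position),
  `flatMap_gateEnc_VB`, `sigmaEncode_family`, `descS_eq`, and **`family_isUniform`**.

## References

* P. W. Shor, SIAM J. Comput. 26 (1997) 1484–1509, §2 (p. 7 of arXiv:quant-ph/9508027v2). [Shor1997]
* A. Yu. Kitaev, arXiv:quant-ph/9511026 (1995), §4 (p. 15). [Kitaev1995]
* S. Arora, B. Barak, *Computational Complexity: A Modern Approach*, CUP 2009, §6.2 (Def. 6.12,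
  Remark 6.7, proof of Thm. 6.15). [AroraBarak2009]
-/

noncomputable section

namespace Literature.Computability.Cryptography

namespace ShiftSampling

open _root_.Computability Complexity Complexity.CodeFP QuantumComplexity QuantumComplexity.RevClean
  QuantumComplexity.RevSim Kitaev1995 PeriodFinding Matrix Finset

namespace SSParams

open QuantumComplexity.RevDesc Complexity.GExpr

attribute [local simp] GExpr.eval

/-- **The parameters as counter expressions in the family index** (so that the description is
printed by generator programs): expressions mentioning only `uu`, evaluating to the parameters.
[cite: AroraBarak2009, §6.2 Def. 6.12 (P-uniform: descriptions printed with counters)] -/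
structure GEParams (P : SSParams) where
  /-- expression for `nU` -/
  nUE : GE
  /-- expression for `L` -/
  LE : GE
  /-- expression for `Lv` -/
  LvE : GE
  /-- expression for `B` -/
  BE : GE
  eval_nUE : ∀ env, nUE.eval env = P.nU (env .uu)
  eval_LE : ∀ env, LE.eval env = P.L (env .uu)
  eval_LvE : ∀ env, LvE.eval env = P.Lv (env .uu)
  eval_BE : ∀ env, BE.eval env = P.B (env .uu)
  fv_nUE : ∀ x ∈ nUE.fv, x = GV.uu
  fv_LE : ∀ x ∈ LE.fv, x = GV.uu
  fv_LvE : ∀ x ∈ LvE.fv, x = GV.uu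
  fv_BE : ∀ x ∈ BE.fv, x = GV.uu

variable (P : SSParams) {tab : List Bool → ℕ → List Bool} (hbf : P.blockFn tab ∈ FP) (Γ : P.GEParams)

namespace GEParams

attribute [simp] eval_nUE eval_LE eval_LvE eval_BE

variable {P}

/-- `K = Lv (2B)`. [folklore] -/
def KE : GE := .mul Γ.LvE (.mul (.const 2) Γ.BE)
/-- `k₁ = nU K`. [folklore] -/
def K1E : GE := .mul Γ.nUE Γ.KE
/-- `k₂ = nU L`. [folklore] -/
def K2E : GE := .mul Γ.nUE Γ.LE
/-- `k₁ + k₂`. [folklore] -/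
def KCE : GE := .add Γ.K1E Γ.K2E
/-- `dataN = uu + (k₁ + k₂)`. [folklore] -/
def dataNE : GE := .add (.var .uu) Γ.KCE
/-- the tableau length `tabLen = dataN + (uu + 1)`. [folklore] -/
def NE : GE := .add Γ.dataNE (.add (.var .uu) (.const 1))

/-- value of `KE` [folklore] -/
@[simp] theorem eval_KE (env : GV → ℕ) : Γ.KE.eval env = P.K (env .uu) := by simp [KE, K]
/-- value of `K1E` [folklore] -/
@[simp] theorem eval_K1E (env : GV → ℕ) : Γ.K1E.eval env = P.k₁ (env .uu) := by simp [K1E, k₁]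
/-- value of `K2E` [folklore] -/
@[simp] theorem eval_K2E (env : GV → ℕ) : Γ.K2E.eval env = P.k₂ (env .uu) := by simp [K2E, k₂]
/-- value of `KCE` [folklore] -/
@[simp] theorem eval_KCE (env : GV → ℕ) : Γ.KCE.eval env = P.k₁ (env .uu) + P.k₂ (env .uu) := by simp [KCE]
/-- value of `dataNE` [folklore] -/
@[simp] theorem eval_dataNE (env : GV → ℕ) : Γ.dataNE.eval env = P.dataN (env .uu) := by simp [dataNE, dataN]
/-- value of `NE` [folklore] -/
@[simp] theorem eval_NE (env : GV → ℕ) : Γ.NE.eval env = P.tabLen (env .uu) := by simp [NE, tabLen]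

/-- `KE` mentions the family index only. [folklore] -/
theorem fv_KE : ∀ x ∈ Γ.KE.fv, x = GV.uu := by
  intro x hx; simp only [KE, GExpr.fv, List.mem_append, List.not_mem_nil, false_or] at hx
  rcases hx with hx | hx
  · exact Γ.fv_LvE x hx
  · exact Γ.fv_BE x hx

/-- `KCE` mentions the family index only. [folklore] -/
theorem fv_KCE : ∀ x ∈ Γ.KCE.fv, x = GV.uu := by
  intro x hx; simp only [KCE, K1E, K2E, GExpr.fv, List.mem_append] at hx
  rcases hx with (hx | hx) | (hx | hx)
  · exact Γ.fv_nUE x hx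
  · exact Γ.fv_KE x hx
  · exact Γ.fv_nUE x hx
  · exact Γ.fv_LE x hx

/-- `NE` mentions the family index only. [folklore] -/
theorem inUU_NE : InUU Γ.NE := by
  intro x hx
  simp only [NE, dataNE, GExpr.fv, List.mem_append, List.mem_singleton, List.not_mem_nil, or_false] at hx
  rcases hx with (rfl | hx) | rfl
  · rfl
  · exact Γ.fv_KCE x hx
  · rfl

/-- `dataNE + 1` mentions the family index only. [folklore] -/
theorem inUU_dataNE_succ : InUU (.add Γ.dataNE (.const 1)) := by
  intro x hx
  simp only [dataNE, GExpr.fv, List.mem_append, List.mem_singleton, List.not_mem_nil, or_false] at hx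
  rcases hx with rfl | hx
  · rfl
  · exact Γ.fv_KCE x hx

end GEParams

/-! ### The work-wire count in closed form -/

/-- The work-wire count in closed form. [folklore] -/
theorem mW_eq (n : ℕ) : P.mW hbf n = (n + 1) + ancN (MB hbf).tm (eB hbf) (P.tabLen n) +
    JJ (eB hbf) (MB hbf) (P.tabLen n) * A₁ (MB hbf) := by
  have h : P.totN hbf n = P.tabLen n + ancN (MB hbf).tm (eB hbf) (P.tabLen n) + JJ (eB hbf) (MB hbf) (P.tabLen n) * A₁ (MB hbf) := rfl
  rw [mW, h, tabLen]
  omega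

/-- the ancilla count `(k₁ + k₂) + mW` as an expression [folklore] -/
def ancE : GE := .add Γ.KCE (.add (.add (.var .uu) (.const 1))
  (.add ((ancNE (MB hbf).tm (eB hbf)).subst (substN Γ.NE)) (.mul ((JJE (eB hbf) (MB hbf)).subst (substN Γ.NE)) (.const (A₁ (MB hbf))))))

/-- value of `ancE` [folklore] -/
@[simp] theorem eval_ancE (env : GV → ℕ) : (P.ancE hbf Γ).eval env = (P.k₁ (env .uu) + P.k₂ (env .uu)) + P.mW hbf (env .uu) := by
  rw [mW_eq]
  simp [ancE, GExpr.eval_subst, eval_substN]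
  ring

/-! ### The generators of the layers -/

/-- **the header** `dbl (bin n) 01 1^{2 anc} 01` [folklore] -/
def headerG : GS :=
  .seq (ticksG (.var .uu)) (.seq (.emit (Tok.dump false true :: litT [false, true]))
    (.seq (.loop .jj (.mul (.const 2) (P.ancE hbf Γ)) (.emit [Tok.lit true])) (.emit (litT [false, true]))))

/-- **the first Hadamard layer**: one `H` on each coin wire `n + j`, `j < k₁ + k₂` [cite: Kitaev1995, §3 (the measuring circuit)] -/
def hLayer1G : GS := .loop .jj Γ.KCE (agateG ⟨.H, [.add (.var .uu) (.var .jj)]⟩)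

/-- **the last Hadamard layer**: one `H` on each control wire `n + j`, `j < k₁` [cite: Kitaev1995, §3 (the measuring circuit)] -/
def hLayer2G : GS := .loop .jj Γ.K1E (agateG ⟨.H, [.add (.var .uu) (.var .jj)]⟩)

/-- the wire of the sine-test control `(u, l, i)`: `n + u K + (l 2B + (B + i))` [folklore] -/
def sWireE : GE := .add (.var .uu) (.add (.mul (.var .tt) Γ.KE)
  (.add (.mul (.var .jj) (.mul (.const 2) Γ.BE)) (.add Γ.BE (.var .xn))))

/-- **the phase layer**: `S³` on every sine-test control wire, unit by unit, level by level
[cite: Kitaev1995, §3 Remark 8 (the phase shift for the sine test)] -/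
def phaseG : GS :=
  .loop .tt Γ.nUE (.loop .jj Γ.LvE (.loop .xn Γ.BE
    (seqs [agateG ⟨.S, [P.sWireE Γ]⟩, agateG ⟨.S, [P.sWireE Γ]⟩, agateG ⟨.S, [P.sWireE Γ]⟩])))

/-- The abstract `H` gate on wire `w`. [folklore] -/
def agH (w : ℕ) : AGate ℕ := ⟨.H, [w]⟩
/-- The abstract `S` gate on wire `w`. [folklore] -/
def agS (w : ℕ) : AGate ℕ := ⟨.S, [w]⟩

variable (env : GV → ℕ)

/-- The header stream. [folklore] -/
theorem out_headerG : (P.headerG hbf Γ).out env =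
    headerToks (env .uu) ((P.k₁ (env .uu) + P.k₂ (env .uu)) + P.mW hbf (env .uu)) := by
  simp [headerG, GStmt.out, headerToks, flatMap_range_const]

/-- The first Hadamard-layer stream. [folklore] -/
theorem out_hLayer1G : (P.hLayer1G Γ).out env =
    ((List.range (P.k₁ (env .uu) + P.k₂ (env .uu))).map fun j => agH (env .uu + j)).flatMap AGate.toks := by
  simp [hLayer1G, GStmt.out, List.flatMap_map, agH, AGate.map]

/-- The last Hadamard-layer stream. [folklore] -/
theorem out_hLayer2G : (P.hLayer2G Γ).out env =
    ((List.range (P.k₁ (env .uu))).map fun j => agH (env .uu + j)).flatMap AGate.toks := by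
  simp [hLayer2G, GStmt.out, List.flatMap_map, agH, AGate.map]

/-- The wire of the sine-test control `(u, l, i)` of the circuit of index `n`. [folklore] -/
def sWire (n u l i : ℕ) : ℕ := n + (u * P.K n + (l * (2 * P.B n) + (P.B n + i)))

/-- The abstract phase layer: `S³` on every sine-test control. [folklore] -/
def phaseGates (n : ℕ) : List (AGate ℕ) :=
  (List.range (P.nU n)).flatMap fun u => (List.range (P.Lv n)).flatMap fun l =>
    (List.range (P.B n)).flatMap fun i => [agS (P.sWire n u l i), agS (P.sWire n u l i), agS (P.sWire n u l i)]

/-- The phase-layer stream. [folklore] -/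
theorem out_phaseG : (P.phaseG Γ).out env = (P.phaseGates (env .uu)).flatMap AGate.toks := by
  simp [phaseG, GStmt.out, sWireE, agS, AGate.map, List.flatMap_assoc, phaseGates, sWire, K]

/-! ### The pieces and their hygiene -/

/-- **Piece A**: header and first Hadamard layer. [folklore] -/
def genA : GS := seqs [P.headerG hbf Γ, P.hLayer1G Γ]

/-- **Piece C**: phase layer and last Hadamard layer. [folklore] -/
def genC : GS := seqs [P.phaseG Γ, P.hLayer2G Γ]

/-- The family index is not a loop variable of piece A. [folklore] -/
theorem uu_not_mem_loopVars_genA : GV.uu ∉ (P.genA hbf Γ).loopVars := fun h => by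
  simp [genA, headerG, hLayer1G, GStmt.loopVars, agateG, seqs, wireG, ticksG] at h

/-- The family index is not a loop variable of piece C. [folklore] -/
theorem uu_not_mem_loopVars_genC : GV.uu ∉ (P.genC Γ).loopVars := fun h => by
  simp [genC, phaseG, hLayer2G, GStmt.loopVars, agateG, seqs, wireG, ticksG] at h

/-- Piece A reuses no loop variable. [folklore] -/
theorem noReuse_genA : (P.genA hbf Γ).noReuse = true := by rfl

/-- Piece C reuses no loop variable. [folklore] -/
theorem noReuse_genC : (P.genC Γ).noReuse = true := by rfl

/-- Piece A rendered. [folklore] -/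
def pieceA (z : List Bool) : List Bool := Tok.render 0 ((P.genA hbf Γ).out (GenProg.initEnv .uu z.length))
/-- Piece B: the clean block. [folklore] -/
def pieceB (z : List Bool) : List Bool := (cleanOps (eB hbf) (MB hbf) (P.dataN z.length) (sufV z.length)).flatMap opBits
/-- Piece C rendered. [folklore] -/
def pieceC (z : List Bool) : List Bool := Tok.render 0 ((P.genC Γ).out (GenProg.initEnv .uu z.length))

/-- **The description of the family as a string function of `1^n`.** [folklore] -/
def descS (z : List Bool) : List Bool := P.pieceA hbf Γ z ++ (P.pieceB hbf z ++ P.pieceC Γ z)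

/-- The suffix `NOT`s of the block are one run described by `(dataNE + 1, uu)`. [folklore] -/
theorem notsV_sufV (u : ℕ) : notsV (Γ.dataNE.eval (envU u)) (sufV u) =
    [(GExpr.add Γ.dataNE (.const 1), GExpr.var GV.uu)].flatMap fun p =>
      (List.range (p.2.eval (envU u))).map fun i => ClOp.not (p.1.eval (envU u) + i) := by
  rw [sufV, show false :: ones u = [false] ++ List.replicate u true from rfl, notsV_append,
    notsV_singleton_false, notsV_replicate_true]
  simp [envU, GenProg.initEnv, Nat.add_assoc]

include Γ in
/-- **`pieceB ∈ FP`** (`CleanBlockDesc.flatMap_opBits_cleanOps_mem_FP`). [cite: AroraBarak2009, §6.2 Remark 6.7] -/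
theorem pieceB_mem_FP : P.pieceB hbf ∈ FP := by
  have h := flatMap_opBits_cleanOps_mem_FP (e := eB hbf) (M := MB hbf) Γ.dataNE Γ.NE [(GExpr.add Γ.dataNE (.const 1), GExpr.var GV.uu)]
    Γ.inUU_NE (fun p hp => by simp at hp; subst hp; exact Γ.inUU_dataNE_succ) (fun u => sufV u)
    (fun u => P.notsV_sufV Γ u) (fun u => by simp [envU, GenProg.initEnv, tabLen, length_sufV])
  refine (congrArg (· ∈ FP) (funext fun z => ?_)).mp h
  simp [pieceB, envU, GenProg.initEnv]

/-- **`descS ∈ FP`** (`GStmt.render_out_mem_FP` for pieces A and C, `pieceB_mem_FP`, `append_mem_FP`).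
[cite: AroraBarak2009, §6.2 (Def. 6.12, proof of Thm. 6.15)] -/
theorem descS_mem_FP : P.descS hbf Γ ∈ FP :=
  QuantumComplexity.append_mem_FP
    (GStmt.render_out_mem_FP (P.genA hbf Γ) .uu (P.uu_not_mem_loopVars_genA hbf Γ) (P.noReuse_genA hbf Γ))
    (QuantumComplexity.append_mem_FP (P.pieceB_mem_FP hbf Γ)
      (GStmt.render_out_mem_FP (P.genC Γ) .uu (P.uu_not_mem_loopVars_genC Γ) (P.noReuse_genC Γ)))

/-! ### The layers of the circuit as bit streams -/

/-- Bits of the abstract `H` gate (as `ModExpBlock.bits_agH`). [folklore] -/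
@[simp] private theorem bits_agH (w : ℕ) : (agH w).bits = gateBits 0 1 [w] := by simp [agH, AGate.bits, symCode, symArity]
/-- Bits of the abstract `S` gate (as `ModExpBlock.bits_agS`). [folklore] -/
@[simp] private theorem bits_agS (w : ℕ) : (agS w).bits = gateBits 1 1 [w] := by simp [agS, AGate.bits, symCode, symArity]

/-- A `flatMap` of empty lists is empty. [folklore] -/
private theorem flatMap_nil' {α β : Type} (l : List α) : (l.flatMap fun _ => ([] : List β)) = [] := by
  induction l with
  | nil => rfl
  | cons a l ih => rw [List.flatMap_cons, ih]; rfl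

/-- A `flatMap` over `finRange` of a function of the value is a `flatMap` over `range`. [folklore] -/
private theorem finRange_flatMap_val' {α : Type} (N : ℕ) (f : ℕ → List α) :
    ((List.finRange N).flatMap fun j : Fin N => f (j : ℕ)) = (List.range N).flatMap f := by
  rw [← List.map_coe_finRange_eq_range, List.flatMap_map]

/-- `flatMap` over a product range (as `ModExpBlock.flatMap_range_mul`, a private copy). [folklore] -/
private theorem flatMap_range_mul {α : Type} (a b : ℕ) (f : ℕ → List α) :
    (List.range (a * b)).flatMap f = (List.range a).flatMap fun t => (List.range b).flatMap fun r => f (t * b + r) := by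
  induction a with
  | zero => simp
  | succ a ih => rw [Nat.succ_mul, flatMap_range_add, ih, List.range_succ, List.flatMap_append, List.flatMap_singleton]

/-- The Hadamard-layer bits over `k` coin wires. [folklore] -/
def hBits (n k : ℕ) : List Bool := ((List.range k).map fun j => agH (n + j)).flatMap AGate.bits

/-- **The first Hadamard layer describes as the bits of the abstract `H` gates.** [folklore] -/
theorem flatMap_gateEnc_hadamardLayer (n k m : ℕ) :
    (QuantumComplexity.hadamardLayer n k m).flatMap gateEnc = hBits n k := by
  rw [hBits, QuantumComplexity.hadamardLayer, coinWires, List.flatMap_map, List.flatMap_map, List.flatMap_map,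
    ← finRange_flatMap_val' k fun j => (agH (n + j)).bits]
  refine List.flatMap_congr fun j _ => ?_
  simp [gateEnc_hOn, val_coinWire]

/-- **The last Hadamard layer (control wires only) describes as the bits of the abstract `H` gates.** [folklore] -/
theorem flatMap_gateEnc_yWires (n k₁ k₂ m : ℕ) :
    ((yWires n k₁ k₂ m).map hOn).flatMap gateEnc = hBits n k₁ := by
  rw [hBits, yWires, List.flatMap_map, List.flatMap_map, List.flatMap_map,
    ← finRange_flatMap_val' k₁ fun j => (agH (n + j)).bits]
  refine List.flatMap_congr fun j _ => ?_
  simp [gateEnc_hOn, yWire, val_coinWire]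

variable (n : ℕ)

/-- The value of `eK.symm (l, σ, i)`: `i + B σ + 2B l`. [folklore] -/
theorem val_eK_symm (l : Fin (P.Lv n)) (σ : Bool) (i : Fin (P.B n)) :
    ((P.eK n).symm (l, σ, i) : ℕ) = (i : ℕ) + P.B n * σ.toNat + 2 * P.B n * l := by
  cases σ <;> rfl

/-- **The type of a control from its position**: control `u K + (l 2B + (σ B + i))` has type `σ`,
and lies below `k₁`. [folklore] -/
theorem famσ_eq {u l i : ℕ} (hu : u < P.nU n) (hl : l < P.Lv n) (hi : i < P.B n) (σ : Bool) :
    ∃ hv : u * P.K n + (l * (2 * P.B n) + (σ.toNat * P.B n + i)) < P.k₁ n, P.famσ n ⟨_, hv⟩ = σ := by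
  have hval : ((P.eCtl n).symm (⟨u, hu⟩, ⟨l, hl⟩, σ, ⟨i, hi⟩) : ℕ) = u * P.K n + (l * (2 * P.B n) + (σ.toNat * P.B n + i)) := by
    rw [val_eCtl_symm, val_eK_symm]; simp only; ring
  refine ⟨hval ▸ ((P.eCtl n).symm (⟨u, hu⟩, ⟨l, hl⟩, σ, ⟨i, hi⟩)).isLt, ?_⟩
  have : (⟨_, hval ▸ ((P.eCtl n).symm (⟨u, hu⟩, ⟨l, hl⟩, σ, ⟨i, hi⟩)).isLt⟩ : Fin (P.k₁ n)) =
      (P.eCtl n).symm (⟨u, hu⟩, ⟨l, hl⟩, σ, ⟨i, hi⟩) := Fin.ext hval.symm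
  rw [this, famσ, Equiv.apply_symm_apply]

/-- `extσ` on a control wire. [folklore] -/
theorem extσ_of_lt {k₁ k₂ : ℕ} (σ : Fin k₁ → Bool) {v : ℕ} (hv : v < k₁) (hv' : v < k₁ + k₂) :
    extσ (k₂ := k₂) σ ⟨v, hv'⟩ = σ ⟨v, hv⟩ := by
  rw [extσ, show (⟨v, hv'⟩ : Fin (k₁ + k₂)) = Fin.castAdd k₂ ⟨v, hv⟩ from rfl, Fin.append_left]

/-- `extσ` on an offset wire. [folklore] -/
theorem extσ_of_le {k₁ k₂ : ℕ} (σ : Fin k₁ → Bool) {v : ℕ} (hv : k₁ ≤ v) (hv' : v < k₁ + k₂) :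
    extσ (k₂ := k₂) σ ⟨v, hv'⟩ = false := by
  rw [extσ, show (⟨v, hv'⟩ : Fin (k₁ + k₂)) = Fin.natAdd k₁ ⟨v - k₁, by omega⟩ from Fin.ext (by simp; omega),
    Fin.append_right]

/-- The phase layer as a function of the position of a coin wire: `S³` on sine-test controls. [folklore] -/
def pF (v : ℕ) : List Bool :=
  if hv : v < P.k₁ n + P.k₂ n then
    (if extσ (P.famσ n) ⟨v, hv⟩ then gateBits 1 1 [n + v] ++ (gateBits 1 1 [n + v] ++ gateBits 1 1 [n + v]) else [])
  else []

/-- `pF` on a cosine-test control. [folklore] -/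
theorem pF_cos {u l i : ℕ} (hu : u < P.nU n) (hl : l < P.Lv n) (hi : i < P.B n) :
    P.pF n (u * P.K n + (l * (2 * P.B n) + i)) = [] := by
  obtain ⟨hv, hσ⟩ := P.famσ_eq n hu hl hi false
  simp only [Bool.toNat_false, zero_mul, zero_add] at hv hσ
  rw [pF, dif_pos (by omega), extσ_of_lt _ hv, hσ]
  rfl

/-- `pF` on a sine-test control. [folklore] -/
theorem pF_sin {u l i : ℕ} (hu : u < P.nU n) (hl : l < P.Lv n) (hi : i < P.B n) :
    P.pF n (u * P.K n + (l * (2 * P.B n) + (P.B n + i))) =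
      gateBits 1 1 [P.sWire n u l i] ++ (gateBits 1 1 [P.sWire n u l i] ++ gateBits 1 1 [P.sWire n u l i]) := by
  obtain ⟨hv, hσ⟩ := P.famσ_eq n hu hl hi true
  simp only [Bool.toNat_true, one_mul] at hv hσ
  rw [pF, dif_pos (by omega), extσ_of_lt _ hv, hσ, if_pos rfl, sWire]

/-- `pF` on an offset wire. [folklore] -/
theorem pF_offset {v : ℕ} (hv : P.k₁ n ≤ v) : P.pF n v = [] := by
  unfold pF
  by_cases h : v < P.k₁ n + P.k₂ n
  · rw [dif_pos h, extσ_of_le _ hv h]; rfl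
  · rw [dif_neg h]

/-- **The phase layer describes as the bits of the abstract `S` gates.** [cite: Kitaev1995, §3 Remark 8] -/
theorem flatMap_gateEnc_phaseLayer (m : ℕ) :
    (phaseLayer n (P.k₁ n + P.k₂ n) m (extσ (P.famσ n))).flatMap gateEnc = (P.phaseGates n).flatMap AGate.bits := by
  -- the layer over `range (k₁ + k₂)` with a dependent test
  have h1 : (phaseLayer n (P.k₁ n + P.k₂ n) m (extσ (P.famσ n))).flatMap gateEnc = (List.range (P.k₁ n + P.k₂ n)).flatMap (P.pF n) := by
    rw [phaseLayer, phaseLayerL, List.flatMap_assoc, ← finRange_flatMap_val' (P.k₁ n + P.k₂ n) (P.pF n)]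
    refine List.flatMap_congr fun j _ => ?_
    rw [pF, dif_pos j.isLt, Fin.eta]
    split_ifs <;> simp [gateEnc_sOn, val_coinWire]
  rw [h1, flatMap_range_add, List.flatMap_congr (l := List.range (P.k₂ n)) (g := fun _ => [])
    (fun r _ => P.pF_offset n (Nat.le_add_right _ _)), flatMap_nil', List.append_nil, k₁, flatMap_range_mul, phaseGates]
  simp only [List.flatMap_assoc]
  refine List.flatMap_congr fun u hu => ?_
  rw [List.mem_range] at hu
  rw [K, flatMap_range_mul]
  refine List.flatMap_congr fun l hl => ?_
  rw [List.mem_range] at hl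
  rw [two_mul, flatMap_range_add]
  rw [List.flatMap_congr (g := fun _ => []) fun r hr => ?_, flatMap_nil', List.nil_append]
  · refine List.flatMap_congr fun i hi => ?_
    rw [List.mem_range] at hi
    rw [← two_mul, show u * (P.Lv n * (2 * P.B n)) + (l * (2 * P.B n) + (P.B n + i)) = u * P.K n + (l * (2 * P.B n) + (P.B n + i)) from rfl,
      P.pF_sin n hu hl hi]
    simp
  · rw [List.mem_range] at hr
    rw [← two_mul]
    exact P.pF_cos n hu hl hr

/-- **The block describes as the `opBits` of the clean program.** [folklore] -/
theorem flatMap_gateEnc_VB : (P.VB hbf n).gates.flatMap gateEnc = (P.opsN hbf n).flatMap opBits :=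
  flatMap_gateEnc_revCompile_toRevList (P.layoutN_pos hbf n) (P.opsN hbf n) (P.opsN_lt hbf n) (P.opsFinB_wf hbf n)

/-- **The description of the `n`-th circuit of the family**, layer by layer. [folklore] -/
theorem sigmaEncode_family :
    QCircuit.sigmaEncode (G := cliffordT) ⟨n, (P.family hbf).ancillas n, (P.family hbf).circ n⟩ =
      SProg.dbl (encodeNat n) ++ [false, true] ++ (List.replicate (2 * ((P.k₁ n + P.k₂ n) + P.mW hbf n)) true ++ [false, true]) ++
        (hBits n (P.k₁ n + P.k₂ n) ++ ((P.opsN hbf n).flatMap opBits ++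
          ((P.phaseGates n).flatMap AGate.bits ++ hBits n (P.k₁ n)))) := by
  change boolPair (encodeNat n) (boolPair (unaryEncodeNat ((P.k₁ n + P.k₂ n) + P.mW hbf n))
    (QCircuit.encode (sandwich (P.VB hbf n) (P.famσ n)))) = _
  rw [sandwich, encode_eq_flatMap, List.flatMap_append, List.flatMap_append, List.flatMap_append,
    flatMap_gateEnc_VB, flatMap_gateEnc_hadamardLayer, P.flatMap_gateEnc_phaseLayer, flatMap_gateEnc_yWires,
    RevDesc.boolPair_eq, RevDesc.boolPair_eq, RevDesc.unaryEncodeNat_eq_replicate, dbl_replicate]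
  simp only [List.append_assoc]

/-- The input variable of the generators holds `n`. [folklore] -/
theorem initEnv_uu : GenProg.initEnv GV.uu n GV.uu = n := by simp [GenProg.initEnv]

/-- **Piece A rendered.** [folklore] -/
theorem pieceA_eq (z : List Bool) : P.pieceA hbf Γ z =
    SProg.dbl (encodeNat z.length) ++ [false, true] ++ (List.replicate (2 * ((P.k₁ z.length + P.k₂ z.length) + P.mW hbf z.length)) true ++ [false, true]) ++
      hBits z.length (P.k₁ z.length + P.k₂ z.length) := by
  rw [pieceA, genA, out_seqs]
  simp only [List.flatMap_cons, List.flatMap_nil, List.append_nil, out_headerG, out_hLayer1G, initEnv_uu]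
  rw [render_headerToks, ← List.append_nil (List.flatMap _ _), render_flatMap_toks, Tok.render_nil, List.append_nil, hBits]

/-- **Piece C rendered.** [folklore] -/
theorem pieceC_eq (z : List Bool) : P.pieceC Γ z =
    (P.phaseGates z.length).flatMap AGate.bits ++ hBits z.length (P.k₁ z.length) := by
  rw [pieceC, genC, out_seqs]
  simp only [List.flatMap_cons, List.flatMap_nil, List.append_nil, out_phaseG, out_hLayer2G, initEnv_uu]
  rw [← List.append_nil (List.flatMap _ ((List.range (P.k₁ z.length)).map _)), render_flatMap_toks, render_flatMap_toks,
    Tok.render_nil, List.append_nil, hBits]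

/-- **The stream identity**: the rendered pieces are the description of the family. [cite: AroraBarak2009, §6.2 (proof of Thm. 6.15: descriptions printed with counters)] -/
theorem descS_eq (z : List Bool) :
    P.descS hbf Γ z = QCircuit.sigmaEncode (G := cliffordT) ⟨z.length, (P.family hbf).ancillas z.length, (P.family hbf).circ z.length⟩ := by
  rw [descS, pieceA_eq, pieceB, pieceC_eq, sigmaEncode_family, opsN]
  simp only [List.append_assoc]

/-! ### Uniformity -/

include Γ in
/-- **The quantum core is polynomial-time uniform** (`descS_mem_FP`, `descS_eq`,
`QCircuitFamily.isUniform_of_mem_FP`): given counter expressions for the parameters, the family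
around the compiled block is `P`-uniform. [cite: Shor1997, §2 p.7 (uniformity of the gate array); Kitaev1995, §4 p.15; AroraBarak2009, §6.2] -/
theorem family_isUniform : (P.family hbf).IsUniform := by
  refine QCircuitFamily.isUniform_of_mem_FP _ ?_
  have h := P.descS_mem_FP hbf Γ
  rw [show P.descS hbf Γ = fun z => QCircuit.sigmaEncode (G := cliffordT)
    ⟨z.length, (P.family hbf).ancillas z.length, (P.family hbf).circ z.length⟩ from funext (P.descS_eq hbf Γ)] at h
  exact h

end SSParams

end ShiftSampling

end Literature.Computability.Cryptography

end
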